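import Mathlib
import Literature.Combinatorics.Optimization.ReflectionRelations
import Literature.Combinatorics.Optimization.ParityPolytopeEF
import HarnessLib

/-!
# The `D_n`-permutahedron of a polytope: Kaibel–Pashkovich's Proposition 7 and Theorem 6 — PROVED

Source: V. Kaibel, K. Pashkovich, *Constructing extended formulations from reflection relations*,
IPCO 2011 [KaibelPashkovich2011] (held text `paper:arxiv-1011.3597`, §4.1.4, arXiv p. 11). Verbatim:
"The group `D_n` is generated by the reflections in `ℝⁿ` at the hyperplanes `H^=(e_k + e_ℓ, 0)` and
`H^=(e_k − e_ℓ, 0)` for all pairwise distinct `k, ℓ ∈ [n]`. … We choose `Φ_{D_n} = {x ∈ ℝⁿ :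
|x_1| ≤ x_2 ≤ ⋯ ≤ x_n}` as the fundamental domain. The orbit of a point `x ∈ ℝⁿ` under the action of
`D_n` consists of all points which can be obtained from `x` by permuting its coordinates and changing
the signs of an even number of its coordinates. For every `x ∈ ℝⁿ`, the point `Φ_{D_n}(x)` arises from
`|x|↑` by multiplying the first component by `−1` in case `x` has an odd number of negative components.
For `k, ℓ ∈ [n]` with `k ≠ ℓ`, we denote the ordered pair `(R_{e_k − e_ℓ, 0}, R_{−e_k − e_ℓ, 0})` of
reflection relations by `E_{k,ℓ}`. **Proposition 7.** Let `𝓡` be induced by a sequence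
`(T_{k_1,ℓ_1}, …, T_{k_r,ℓ_r}, E_{1,2}, …, E_{n−1,n})` of polyhedral relations, where `(k_1, ℓ_1), …,
(k_r, ℓ_r)` is a sorting network. If `P ⊆ ℝⁿ` is a polytope with `Φ_{D_n}(v) ∈ P` for each vertex `v`
of `P`, then we have `𝓡(P) = Π_{D_n}(P)`. *Proof.* … we define `η*_{k,ℓ} = ϱ*_{H^≤(e_k − e_ℓ,0)} ∘
ϱ*_{H^≤(−e_k − e_ℓ,0)}`. For each `y ∈ ℝⁿ`, the vector `η*_{k,ℓ}(y)` is the vector `y' ∈ {y, τ_{k,ℓ}(y),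
ρ_{k,ℓ}(y), ρ_{k,ℓ}(τ_{k,ℓ}(y))}` with `|y'_k| ≤ y'_ℓ`, where `ρ_{k,ℓ}(y)` arises from `y` by multiplying
both components `k` and `ℓ` by `−1`. As, for every `w ∈ W` …, we have `τ* ∘ ⋯ ∘ τ* ∘ η*_{1,2} ∘ ⋯ ∘
η*_{n−1,n}(w) = Φ_{D_n}(w) = Φ_{D_n}(v) ∈ P`, also the second condition of Theorem 1 is satisfied.
**Theorem 6.** For each polytope `P ⊆ ℝⁿ` with `Φ_{D_n}(v) ∈ P` for each vertex `v` of `P` that admits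
an extended formulation with `n'` variables and `f'` inequalities, there is an extended formulation of
`Π_{D_n}(P)` with `n' + O(n log n)` variables and `f' + O(n log n)` inequalities."

Builds on `ReflectionRelations.lean` (Theorem 1, `transSeq`/`sortVec`, Propositions 5–6) and
`ParityPolytopeEF.lean` (the relations `E_{k,k+1}`: `tNormal`, `eNormal`, `paritySeq`, lifting lemmas;
there Proposition 7 is proved only for the two one-point polytopes `{𝟙}`, `{(−1,1,…,1)}`).

## What is proved (no named fact)

* the reflections of `paritySeq m` are signed coordinate permutations of the two kinds `τ_{k,ℓ}` and
  `ρ_{k,ℓ} ∘ τ_{k,ℓ}` (`IsDnGenerator`, `paritySeq_isDnGenerator`); the `D_n`-orbit `dnOrbit V` (a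
  permutation and an EVEN set of sign changes, `DnIndex`), the **`D_n`-permutahedron** `dnHull P =
  conv(dnOrbit P)`, `dnHull_convexHull`, and its closure under both kinds of generators
  (`comp_swap_mem_dnOrbit`, `flip_flip_comp_swap_mem_dnOrbit` — two sign toggles keep the parity —,
  `IsDnGenerator.mem_dnHull`): condition 1 of Theorem 1;
* **`η*_{1,2}` on arbitrary reals** (`etaStar_real`: coordinates `(± min(|y_1|,|y_2|), max(|y_1|,|y_2|))`,
  product preserved) and the composite chain (`eta_spec`: up to a coordinate permutation the result is
  `|w|` with `±` the least absolute value in front, product of coordinates preserved);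
* `sortVec_update_neg_min` (sorting a nonnegative vector whose minimal first entry is negated),
  `dnRep` = `Φ_{D_n}` written with the sign of `∏ x_i` and its agreement with the printed parity form
  `dnRepPrinted` (`dnRep_eq_dnRepPrinted`, `prod_nonneg_iff_even`), **`sortVec_canonSeq_paritySeq :
  sort(η* ∘ ⋯ ∘ η*(w)) = Φ_{D_n}(w)`** and the orbit invariance `dnRep_flipSigns_comp_perm`
  (`Φ_{D_n}(γ.ε.v) = Φ_{D_n}(v)`): condition 2 of Theorem 1;
* **Proposition 7** `KaibelPashkovich2011_prop7 : seqImage (transSeq N ++ paritySeq m) P = dnHull P`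
  (sorting `N`, `P = conv V`, `Φ_{D_n}(v) ∈ P` for `v ∈ V`) and **Theorem 6**
  `KaibelPashkovich2011_thm6 : HasEFOfSize P r → HasEFOfSize (dnHull P) (r + 2|N| + 4m)` on `ℝ^{m+1}`,
  unconditionally `KaibelPashkovich2011_thm6_nlogsq` (`r + n(⌈log₂ n⌉² + 4) + 4(n − 1)`, Batcher).

Deviations from print: a generating set `V` replaces "the vertices"; `Φ_{D_n}` is defined through
`sign ∏ x_i` (equal to the printed rule, `dnRep_eq_dnRepPrinted`); `O(n log n)` (AKS) is replaced by an
explicit network size resp. Batcher's bound; degenerate comparators of the tree's networks are dropped by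
`transSeq`. Honest framing: Literature infrastructure on extended formulations; nothing here bears on
`P ≠ NP`.
-/

noncomputable section

namespace Literature.Combinatorics.Optimization

open Finset Literature.Barriers.PneNP ParityPolytope

variable {m n : ℕ}

/-! ### The reflections of the sequence `(E_{1,2}, …, E_{n−1,n})` as signed coordinate permutations -/

/-- `1 ≠ 0` in `Fin (m + 2)`. [folklore] -/
private theorem one_ne_zero_fin' : (1 : Fin (m + 2)) ≠ 0 := by simp

/-- `k + 2 ≠ 1` in `Fin (m + 2)`. [folklore] -/
private theorem succ_succ_ne_one' (k : Fin m) : (k.succ.succ : Fin (m + 2)) ≠ 1 := by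
  intro h
  have := congrArg Fin.val h
  rw [Fin.val_succ, Fin.val_succ, Fin.val_one] at this
  omega

/-- `τ_{1,2}` is the coordinate transposition. [cite: KaibelPashkovich2011, §4.1.2 (arXiv p. 10)] -/
theorem reflectAt_tNormal_eq_comp_swap (y : Fin (m + 2) → ℝ) :
    reflectAt (tNormal m) 0 y = y ∘ ⇑(Equiv.swap 0 1) := by
  rw [reflectAt_tNormal, Equiv.comp_swap_eq_update]

/-- The reflection of `R_{−e_1−e_2, 0}` is "swap and change both signs". [cite: KaibelPashkovich2011, Prop. 7, proof (arXiv p. 11)] -/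
theorem reflectAt_eNormal_eq (y : Fin (m + 2) → ℝ) :
    reflectAt (eNormal m) 0 y = flipSigns {0} (flipSigns {1} (y ∘ ⇑(Equiv.swap 0 1))) := by
  rw [reflectAt_eNormal]
  ext k
  by_cases hk0 : k = 0
  · subst hk0
    simp [flipSigns]
  · by_cases hk1 : k = 1
    · subst hk1
      simp [flipSigns]
    · simp [flipSigns, hk0, hk1, Equiv.swap_apply_of_ne_of_ne hk0 hk1]

/-- Transposing shifted coordinates. [folklore] -/
private theorem swap_succ_succ_apply_succ (i j k : Fin (m + 1)) :
    Equiv.swap i.succ j.succ k.succ = (Equiv.swap i j k).succ := by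
  by_cases hi : k = i
  · subst hi; simp
  · by_cases hj : k = j
    · subst hj; simp
    · rw [Equiv.swap_apply_of_ne_of_ne (by simpa [Fin.succ_inj] using hi) (by simpa [Fin.succ_inj] using hj),
        Equiv.swap_apply_of_ne_of_ne hi hj]

/-- A transposition of shifted coordinates fixes `0`. [folklore] -/
private theorem swap_succ_succ_apply_zero (i j : Fin (m + 1)) :
    Equiv.swap i.succ j.succ (0 : Fin (m + 2)) = 0 :=
  Equiv.swap_apply_of_ne_of_ne (Fin.succ_ne_zero i).symm (Fin.succ_ne_zero j).symm

/-- Lifting a transposition by one leading coordinate. [cite: KaibelPashkovich2011, Prop. 7 (arXiv p. 11)] -/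
theorem cons_comp_swap (x : Fin (m + 2) → ℝ) (i j : Fin (m + 1)) :
    (Fin.cons (x 0) (Fin.tail x ∘ ⇑(Equiv.swap i j)) : Fin (m + 2) → ℝ) = x ∘ ⇑(Equiv.swap i.succ j.succ) := by
  ext k
  refine Fin.cases ?_ (fun l => ?_) k
  · simp [swap_succ_succ_apply_zero]
  · simp [Fin.tail, swap_succ_succ_apply_succ]

/-- Lifting "swap and change both signs" by one leading coordinate. [cite: KaibelPashkovich2011, Prop. 7 (arXiv p. 11)] -/
theorem cons_flip_flip_comp_swap (x : Fin (m + 2) → ℝ) (i j : Fin (m + 1)) :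
    (Fin.cons (x 0) (flipSigns {i} (flipSigns {j} (Fin.tail x ∘ ⇑(Equiv.swap i j)))) : Fin (m + 2) → ℝ) =
      flipSigns {i.succ} (flipSigns {j.succ} (x ∘ ⇑(Equiv.swap i.succ j.succ))) := by
  ext k
  refine Fin.cases ?_ (fun l => ?_) k
  · simp [flipSigns, swap_succ_succ_apply_zero, (Fin.succ_ne_zero _).symm]
  · simp [flipSigns, Fin.tail, swap_succ_succ_apply_succ, Fin.succ_inj]

/-- The two kinds of `D_n`-reflections used: a coordinate transposition `τ_{k,ℓ}`, or `ρ_{k,ℓ} ∘ τ_{k,ℓ}`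
(transposition with both signs changed). [cite: KaibelPashkovich2011, §4.1.4 (arXiv p. 11)] -/
def IsDnGenerator (f : (Fin n → ℝ) → (Fin n → ℝ)) : Prop :=
  ∃ i j : Fin n, (∀ x, f x = x ∘ ⇑(Equiv.swap i j)) ∨
    (∀ x, f x = flipSigns {i} (flipSigns {j} (x ∘ ⇑(Equiv.swap i j))))

/-- Every reflection of the sequence `(E_{1,2}, …, E_{m,m+1})` is of one of the two kinds.
[cite: KaibelPashkovich2011, Prop. 7, proof (arXiv p. 11)] -/
theorem paritySeq_isDnGenerator : ∀ (m : ℕ), ∀ h ∈ paritySeq m, IsDnGenerator (reflectAt h.1 h.2)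
  | 0 => by simp [paritySeq]
  | m + 1 => by
      intro h hh
      rw [paritySeq, List.mem_cons, List.mem_cons, List.mem_map] at hh
      rcases hh with rfl | rfl | ⟨h', hh', rfl⟩
      · exact ⟨0, 1, Or.inl fun x => reflectAt_tNormal_eq_comp_swap x⟩
      · exact ⟨0, 1, Or.inr fun x => reflectAt_eNormal_eq x⟩
      · obtain ⟨i, j, hij⟩ := paritySeq_isDnGenerator m h' hh'
        refine ⟨i.succ, j.succ, ?_⟩
        rcases hij with hs | hs
        · left
          intro x
          show reflectAt (Fin.cons 0 h'.1) h'.2 x = _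
          rw [reflectAt_cons_zero, hs, cons_comp_swap]
        · right
          intro x
          show reflectAt (Fin.cons 0 h'.1) h'.2 x = _
          rw [reflectAt_cons_zero, hs, cons_flip_flip_comp_swap]

/-! ### The `D_n`-orbit and the `D_n`-permutahedron -/

/-- The index set of `D_n`: a coordinate permutation and an EVEN set of sign changes.
[cite: KaibelPashkovich2011, §4.1.4 (arXiv p. 11)] -/
abbrev DnIndex (n : ℕ) : Type := {p : Equiv.Perm (Fin n) × Finset (Fin n) // Even p.2.card}

/-- The orbit of `V` under `D_n`: "all points which can be obtained from `x` by permuting its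
coordinates and changing the signs of an even number of its coordinates".
[cite: KaibelPashkovich2011, §4.1.4 (arXiv p. 11)] -/
def dnOrbit (V : Set (Fin n → ℝ)) : Set (Fin n → ℝ) :=
  ⋃ p : DnIndex n, (fun x : Fin n → ℝ => flipSigns p.1.2 x ∘ ⇑p.1.1) '' V

/-- The **`D_n`-permutahedron** `Π_{D_n}(P) = conv ⋃_{γ ∈ D_n} γ.P`. [cite: KaibelPashkovich2011, §4.1.4 (arXiv p. 11)] -/
def dnHull (P : Set (Fin n → ℝ)) : Set (Fin n → ℝ) := convexHull ℝ (dnOrbit P)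

/-- `Π_{D_n}(conv V) = conv(W)`, `W = {γ.ε.v}`. [cite: KaibelPashkovich2011, Prop. 7, proof (arXiv p. 11)] -/
theorem dnHull_convexHull (V : Set (Fin n → ℝ)) : dnHull (convexHull ℝ V) = convexHull ℝ (dnOrbit V) :=
  convexHull_iUnion_image_convexHull (fun p : DnIndex n => signPermLin p.1) V

/-- `P ⊆ Π_{D_n}(P)`. [cite: KaibelPashkovich2011, Prop. 7, proof (arXiv p. 11)] -/
theorem subset_dnHull (P : Set (Fin n → ℝ)) : P ⊆ dnHull P := fun x hx =>
  subset_convexHull ℝ _ (Set.mem_iUnion.2 ⟨⟨(1, ∅), by simp⟩, x, hx, by simp⟩)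

/-- Toggling one element changes the parity of a finite set. [folklore] -/
private theorem even_card_toggle_iff (S : Finset (Fin n)) (k : Fin n) :
    Even (if k ∈ S then S.erase k else insert k S).card ↔ ¬Even S.card := by
  split_ifs with hk
  · rw [Finset.card_erase_of_mem hk]
    obtain ⟨c, hc⟩ : ∃ c, S.card = c + 1 := ⟨S.card - 1, by have := Finset.card_pos.2 ⟨k, hk⟩; omega⟩
    rw [hc, Nat.add_sub_cancel, Nat.even_add_one, not_not]
  · rw [Finset.card_insert_of_notMem hk, Nat.even_add_one]

/-- The orbit is closed under coordinate transpositions. [cite: KaibelPashkovich2011, Prop. 7, proof (arXiv p. 11)] -/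
theorem comp_swap_mem_dnOrbit (i j : Fin n) {V : Set (Fin n → ℝ)} {w : Fin n → ℝ} (hw : w ∈ dnOrbit V) :
    w ∘ ⇑(Equiv.swap i j) ∈ dnOrbit V := by
  obtain ⟨⟨⟨σ, S⟩, hS⟩, ⟨v, hv, rfl⟩⟩ := Set.mem_iUnion.1 hw
  refine Set.mem_iUnion.2 ⟨⟨(σ * Equiv.swap i j, S), hS⟩, v, hv, ?_⟩
  simp only [Equiv.Perm.coe_mul, Function.comp_assoc]

/-- The orbit is closed under "swap and change both signs". [cite: KaibelPashkovich2011, Prop. 7, proof (arXiv p. 11)] -/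
theorem flip_flip_comp_swap_mem_dnOrbit (i j : Fin n) {V : Set (Fin n → ℝ)} {w : Fin n → ℝ}
    (hw : w ∈ dnOrbit V) : flipSigns {i} (flipSigns {j} (w ∘ ⇑(Equiv.swap i j))) ∈ dnOrbit V := by
  obtain ⟨⟨⟨σ, S⟩, hS⟩, ⟨v, hv, rfl⟩⟩ := Set.mem_iUnion.1 hw
  dsimp only
  set σ' := σ * Equiv.swap i j with hσ'
  have h1 : (flipSigns S v ∘ ⇑σ) ∘ ⇑(Equiv.swap i j) = flipSigns S v ∘ ⇑σ' := by
    rw [hσ', Equiv.Perm.coe_mul, Function.comp_assoc]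
  set S₁ := if σ' j ∈ S then S.erase (σ' j) else insert (σ' j) S with hS₁
  set S₂ := if σ' i ∈ S₁ then S₁.erase (σ' i) else insert (σ' i) S₁ with hS₂
  have h2 : flipSigns {i} (flipSigns {j} (flipSigns S v ∘ ⇑σ')) = flipSigns S₂ v ∘ ⇑σ' := by
    rw [flipSigns_singleton_comp_perm, flipSigns_singleton_flipSigns, ← hS₁, flipSigns_singleton_comp_perm,
      flipSigns_singleton_flipSigns, ← hS₂]
  have hS₂even : Even S₂.card := by
    rw [hS₂, even_card_toggle_iff, hS₁, even_card_toggle_iff, not_not]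
    exact hS
  rw [h1, h2]
  exact Set.mem_iUnion.2 ⟨⟨(σ', S₂), hS₂even⟩, v, hv, rfl⟩

/-- A linear map preserving `W` preserves `conv W`. [folklore] -/
private theorem linear_mem_convexHull {E : Type*} [AddCommGroup E] [Module ℝ E] {W : Set E}
    (L : E →ₗ[ℝ] E) (hW : ∀ w ∈ W, L w ∈ W) {x : E} (hx : x ∈ convexHull ℝ W) : L x ∈ convexHull ℝ W := by
  have : L x ∈ (L : E → E) '' convexHull ℝ W := ⟨x, hx, rfl⟩
  rw [L.image_convexHull] at this
  refine convexHull_mono ?_ this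
  rintro _ ⟨w, hw, rfl⟩
  exact hW w hw

/-- `Π_{D_n}(P)` is closed under the reflections of the sequence ("the first condition of Theorem 1 is
satisfied"). [cite: KaibelPashkovich2011, Prop. 7, proof (arXiv p. 11)] -/
theorem IsDnGenerator.mem_dnHull {f : (Fin n → ℝ) → (Fin n → ℝ)} (hf : IsDnGenerator f)
    {P : Set (Fin n → ℝ)} {x : Fin n → ℝ} (hx : x ∈ dnHull P) : f x ∈ dnHull P := by
  obtain ⟨i, j, h | h⟩ := hf
  · rw [h]
    exact linear_mem_convexHull (LinearMap.funLeft ℝ ℝ ⇑(Equiv.swap i j))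
      (fun w hw => comp_swap_mem_dnOrbit i j hw) hx
  · rw [h]
    exact linear_mem_convexHull
      ((flipLin {i}).comp ((flipLin {j}).comp (LinearMap.funLeft ℝ ℝ ⇑(Equiv.swap i j))))
      (fun w hw => flip_flip_comp_swap_mem_dnOrbit i j hw) hx

/-- Likewise for plain coordinate transpositions (the sorting-network prefix).
[cite: KaibelPashkovich2011, Prop. 7, proof (arXiv p. 11)] -/
theorem comp_swap_mem_dnHull (i j : Fin n) {P : Set (Fin n → ℝ)} {x : Fin n → ℝ} (hx : x ∈ dnHull P) :
    x ∘ ⇑(Equiv.swap i j) ∈ dnHull P :=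
  IsDnGenerator.mem_dnHull ⟨i, j, Or.inl fun _ => rfl⟩ hx


/-! ### `η*_{1,2}` on arbitrary reals, and the composite `η*_{1,2} ∘ ⋯ ∘ η*_{n−1,n}` -/

/-- **`η*_{k,ℓ}(y)` is "the vector `y' ∈ {y, τ(y), ρ(y), ρ(τ(y))}` with `|y'_k| ≤ y'_ℓ`"**: on the two
coordinates it produces `(± min(|y_k|, |y_ℓ|), max(|y_k|, |y_ℓ|))` with the product `y_k y_ℓ` unchanged,
and it leaves the other coordinates alone. [cite: KaibelPashkovich2011, Prop. 7, proof (arXiv p. 11)] -/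
theorem etaStar_real (y : Fin (m + 2) → ℝ) :
    (∀ k : Fin m, canon (tNormal m) 0 (canon (eNormal m) 0 y) k.succ.succ = y k.succ.succ) ∧
    canon (tNormal m) 0 (canon (eNormal m) 0 y) 1 = max |y 0| |y 1| ∧
    |canon (tNormal m) 0 (canon (eNormal m) 0 y) 0| = min |y 0| |y 1| ∧
    canon (tNormal m) 0 (canon (eNormal m) 0 y) 0 * canon (tNormal m) 0 (canon (eNormal m) 0 y) 1 =
      y 0 * y 1 := by
  have hne := (one_ne_zero_fin' (m := m))
  by_cases hE : eNormal m ⬝ᵥ y ≤ 0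
  · -- `y₀ + y₁ ≥ 0`: keep
    have hin : canon (eNormal m) 0 y = y := by rw [canon, if_pos hE]
    rw [eNormal_dotProduct] at hE
    rw [hin]
    by_cases hT : tNormal m ⬝ᵥ y ≤ 0
    · -- `y₀ ≤ y₁`: keep
      rw [canon, if_pos hT]
      rw [tNormal_dotProduct] at hT
      have h1 : 0 ≤ y 1 := by linarith
      have hab : |y 0| ≤ |y 1| := by rw [abs_of_nonneg h1]; exact abs_le.2 ⟨by linarith, by linarith⟩
      refine ⟨fun k => rfl, ?_, ?_, rfl⟩
      · rw [max_eq_right hab, abs_of_nonneg h1]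
      · rw [min_eq_left hab]
    · -- `y₀ > y₁`: transpose
      rw [canon, if_neg hT, reflectAt_tNormal]
      rw [tNormal_dotProduct] at hT
      push Not at hT
      have h0 : 0 ≤ y 0 := by linarith
      have hab : |y 1| ≤ |y 0| := by rw [abs_of_nonneg h0]; exact abs_le.2 ⟨by linarith, by linarith⟩
      refine ⟨fun k => ?_, ?_, ?_, ?_⟩
      · rw [Function.update_of_ne (Fin.succ_ne_zero _), Function.update_of_ne (succ_succ_ne_one' k)]
      · rw [Function.update_of_ne hne, Function.update_self, max_eq_left hab, abs_of_nonneg h0]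
      · rw [Function.update_self, min_eq_right hab]
      · rw [Function.update_self, Function.update_of_ne hne, Function.update_self, mul_comm]
  · -- `y₀ + y₁ < 0`: `ρτ` first
    have hin : canon (eNormal m) 0 y = Function.update (Function.update y 1 (-y 0)) 0 (-y 1) := by
      rw [canon, if_neg hE, reflectAt_eNormal]
    rw [eNormal_dotProduct] at hE
    push Not at hE
    rw [hin]
    set w := Function.update (Function.update y 1 (-y 0)) 0 (-y 1) with hw
    have hw0 : w 0 = -y 1 := by rw [hw, Function.update_self]
    have hw1 : w 1 = -y 0 := by rw [hw, Function.update_of_ne hne, Function.update_self]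
    have hws : ∀ k : Fin m, w k.succ.succ = y k.succ.succ := fun k => by
      rw [hw, Function.update_of_ne (Fin.succ_ne_zero _), Function.update_of_ne (succ_succ_ne_one' k)]
    by_cases hT : tNormal m ⬝ᵥ w ≤ 0
    · -- `−y₁ ≤ −y₀`: keep
      rw [canon, if_pos hT]
      rw [tNormal_dotProduct, hw0, hw1] at hT
      have h0 : y 0 < 0 := by linarith
      have hab : |y 1| ≤ |y 0| := by rw [abs_of_neg h0]; exact abs_le.2 ⟨by linarith, by linarith⟩
      refine ⟨hws, ?_, ?_, ?_⟩
      · rw [hw1, max_eq_left hab, abs_of_neg h0]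
      · rw [hw0, abs_neg, min_eq_right hab]
      · rw [hw0, hw1]; ring
    · -- `−y₁ > −y₀`: transpose
      rw [canon, if_neg hT, reflectAt_tNormal]
      rw [tNormal_dotProduct, hw0, hw1] at hT
      push Not at hT
      have h1 : y 1 < 0 := by linarith
      have hab : |y 0| ≤ |y 1| := by rw [abs_of_neg h1]; exact abs_le.2 ⟨by linarith, by linarith⟩
      refine ⟨fun k => ?_, ?_, ?_, ?_⟩
      · rw [Function.update_of_ne (Fin.succ_ne_zero _), Function.update_of_ne (succ_succ_ne_one' k), hws]
      · rw [Function.update_of_ne hne, Function.update_self, hw0, max_eq_right hab, abs_of_neg h1]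
      · rw [Function.update_self, hw1, abs_neg, min_eq_left hab]
      · rw [Function.update_self, Function.update_of_ne hne, Function.update_self, hw0, hw1]; ring

/-- **The composite `η*_{1,2} ∘ ⋯ ∘ η*_{n−1,n}(w)`**: up to a coordinate permutation `π` it is `|w|`,
except that coordinate `1` carries `±` the SMALLEST absolute value; the product of the coordinates is
unchanged. [cite: KaibelPashkovich2011, Prop. 7, proof (arXiv p. 11)] -/
theorem eta_spec : ∀ (m : ℕ) (w : Fin (m + 1) → ℝ), ∃ π : Equiv.Perm (Fin (m + 1)),
    (∀ i, i ≠ 0 → canonSeq (paritySeq m) w i = |w (π i)|) ∧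
    |canonSeq (paritySeq m) w 0| = |w (π 0)| ∧ (∀ i, |w (π 0)| ≤ |w (π i)|) ∧
    ∏ i, canonSeq (paritySeq m) w i = ∏ i, w i
  | 0, w => by
      refine ⟨1, fun i hi => absurd (Fin.fin_one_eq_zero i) hi, by simp [paritySeq, canonSeq],
        fun i => by rw [Fin.fin_one_eq_zero i], by simp [paritySeq, canonSeq]⟩
  | m + 1, w => by
      obtain ⟨π, hπ1, hπ0, hmin, hprod⟩ := eta_spec m (Fin.tail w)
      set u := canonSeq (paritySeq m) (Fin.tail w) with hu
      set y : Fin (m + 2) → ℝ := Fin.cons (w 0) u with hy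
      have hstep : canonSeq (paritySeq (m + 1)) w = canon (tNormal m) 0 (canon (eNormal m) 0 y) := by
        rw [paritySeq, canonSeq, canonSeq, canonSeq_map_liftRel]
      obtain ⟨hz2, hz1, hz0, hzp⟩ := etaStar_real y
      set z := canon (tNormal m) 0 (canon (eNormal m) 0 y) with hz
      have hy0 : y 0 = w 0 := by simp [hy]
      have hy1 : y 1 = u 0 := by rw [hy, show (1 : Fin (m + 2)) = Fin.succ 0 from rfl, Fin.cons_succ]
      have hys : ∀ k : Fin (m + 1), y k.succ = u k := fun k => by rw [hy, Fin.cons_succ]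
      -- the product
      have hprodz : ∏ i, z i = ∏ i, w i := by
        calc ∏ i, z i = z 0 * (z 1 * ∏ k : Fin m, z k.succ.succ) := by
              rw [Fin.prod_univ_succ, Fin.prod_univ_succ]; rfl
          _ = (y 0 * y 1) * ∏ k : Fin m, y k.succ.succ := by
              rw [← mul_assoc, hzp]
              exact congrArg _ (Finset.prod_congr rfl fun k _ => hz2 k)
          _ = y 0 * ∏ k : Fin (m + 1), y k.succ := by
              rw [Fin.prod_univ_succ (fun k : Fin (m + 1) => y k.succ), Fin.succ_zero_eq_one]; ring
          _ = w 0 * ∏ k : Fin (m + 1), Fin.tail w k := by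
              rw [hy0, ← hprod]
              exact congrArg _ (Finset.prod_congr rfl fun k _ => hys k)
          _ = ∏ i, w i := by rw [Fin.prod_univ_succ w]; rfl
      -- lift `π`
      set π₁ : Equiv.Perm (Fin (m + 2)) := Equiv.Perm.decomposeFin.symm (0, π) with hπ₁
      have hπ₁0 : π₁ 0 = 0 := Equiv.Perm.decomposeFin_symm_apply_zero 0 π
      have hπ₁s : ∀ k, π₁ k.succ = (π k).succ := fun k => by
        rw [hπ₁, Equiv.Perm.decomposeFin_symm_apply_succ, Equiv.swap_self, Equiv.refl_apply]
      have htail : ∀ k : Fin (m + 1), Fin.tail w k = w k.succ := fun k => rfl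
      rw [hstep]
      by_cases hcmp : |w 0| ≤ |u 0|
      · -- the new minimum is `|w 0|`, kept (up to sign) at coordinate `0`
        refine ⟨π₁, ?_, ?_, ?_, hprodz⟩
        · intro i hi
          obtain ⟨k, rfl⟩ := Fin.exists_succ_eq.2 hi
          rw [hπ₁s]
          refine Fin.cases ?_ (fun l => ?_) k
          · rw [show (Fin.succ 0 : Fin (m + 2)) = 1 from rfl, hz1, hy0, hy1, max_eq_right hcmp, hπ0, htail]
          · rw [hz2, hys, hπ1 _ (Fin.succ_ne_zero l), htail]
        · rw [hz0, hy0, hy1, min_eq_left hcmp, hπ₁0]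
        · intro i
          rw [hπ₁0]
          refine Fin.cases le_rfl (fun k => ?_) i
          rw [hπ₁s]
          calc |w 0| ≤ |u 0| := hcmp
            _ = |Fin.tail w (π 0)| := hπ0
            _ ≤ |Fin.tail w (π k)| := hmin k
      · -- the minimum stays `|u 0| = |w (π 0).succ|`, now at coordinate `0`; `|w 0|` moves to `1`
        push Not at hcmp
        refine ⟨π₁ * Equiv.swap 0 1, ?_, ?_, ?_, hprodz⟩
        · intro i hi
          rw [Equiv.Perm.coe_mul, Function.comp_apply]
          obtain ⟨k, rfl⟩ := Fin.exists_succ_eq.2 hi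
          refine Fin.cases ?_ (fun l => ?_) k
          · rw [show (Fin.succ 0 : Fin (m + 2)) = 1 from rfl, Equiv.swap_apply_right, hπ₁0, hz1, hy0, hy1,
              max_eq_left hcmp.le]
          · rw [Equiv.swap_apply_of_ne_of_ne (Fin.succ_ne_zero _) (succ_succ_ne_one' l), hπ₁s, hz2, hys,
              hπ1 _ (Fin.succ_ne_zero l), htail]
        · rw [Equiv.Perm.coe_mul, Function.comp_apply, Equiv.swap_apply_left,
            show (1 : Fin (m + 2)) = Fin.succ 0 from rfl, hπ₁s, ← htail, ← hπ0, hz0, hy0, hy1,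
            min_eq_right hcmp.le]
        · intro i
          rw [Equiv.Perm.coe_mul, Function.comp_apply, Function.comp_apply, Equiv.swap_apply_left,
            show (1 : Fin (m + 2)) = Fin.succ 0 from rfl, hπ₁s, ← htail, ← hπ0]
          by_cases hi0 : i = 0
          · rw [hi0, Equiv.swap_apply_left, hπ₁s, ← htail, ← hπ0]
          · by_cases hi1 : i = Fin.succ 0
            · rw [hi1, Equiv.swap_apply_right, hπ₁0]
              exact hcmp.le
            · obtain ⟨k, rfl⟩ := Fin.exists_succ_eq.2 hi0
              rw [Equiv.swap_apply_of_ne_of_ne hi0 hi1, hπ₁s]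
              calc |u 0| = |Fin.tail w (π 0)| := hπ0
                _ ≤ |Fin.tail w (π k)| := hmin k


/-! ### Sorting a vector whose only negative entry is minus its least absolute value -/

/-- If `a ≥ 0` has its minimum at coordinate `0`, then `sort(a)` starts with `a 0`, and negating that
entry commutes with sorting: `sort(a with a₀ ↦ −a₀) = sort(a) with first entry `−a₀``.
[cite: KaibelPashkovich2011, Prop. 7, proof (arXiv p. 11: "`Φ(x)` arises from `|x|↑` by multiplying the first component by `−1`")] -/
theorem sortVec_update_neg_min {a : Fin (m + 1) → ℝ} (hmin : ∀ i, a 0 ≤ a i) (h0 : 0 ≤ a 0) :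
    sortVec a 0 = a 0 ∧
      sortVec (Function.update a 0 (-a 0)) = Function.update (sortVec a) 0 (-a 0) := by
  classical
  set ρ := Tuple.sort a with hρ
  have hmono : Monotone (a ∘ ⇑ρ) := Tuple.monotone_sort a
  set t := ρ.symm 0 with ht
  have hρt : ρ t = 0 := by rw [ht, Equiv.apply_symm_apply]
  -- on `[0, t]` the sorted vector is constant `= a 0`
  have hconst : ∀ s, s ≤ t → a (ρ s) = a 0 := by
    intro s hs
    have h1 : a (ρ s) ≤ a (ρ t) := hmono hs
    rw [hρt] at h1
    exact le_antisymm h1 (hmin _)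
  -- the modified sorting permutation `ρ' = ρ ∘ swap 0 t` fixes the value sequence and has `ρ' 0 = 0`
  set ρ' := ρ * Equiv.swap 0 t with hρ'
  have hρ'0 : ρ' 0 = 0 := by rw [hρ', Equiv.Perm.coe_mul, Function.comp_apply, Equiv.swap_apply_left, hρt]
  have hcomp : a ∘ ⇑ρ' = a ∘ ⇑ρ := by
    funext s
    simp only [hρ', Equiv.Perm.coe_mul, Function.comp_apply]
    by_cases hs0 : s = 0
    · rw [hs0, Equiv.swap_apply_left, hρt, hconst 0 (Fin.zero_le _)]
    · by_cases hst : s = t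
      · rw [hst, Equiv.swap_apply_right, hρt, hconst 0 (Fin.zero_le _)]
      · rw [Equiv.swap_apply_of_ne_of_ne hs0 hst]
  have hsort : sortVec a = a ∘ ⇑ρ' := (comp_eq_sortVec_of_monotone (hcomp ▸ hmono)).symm
  have hfirst : sortVec a 0 = a 0 := by rw [hsort, Function.comp_apply, hρ'0]
  refine ⟨hfirst, ?_⟩
  -- the negated vector composed with `ρ'` is `sort(a)` with first entry negated, still monotone
  set g := Function.update a 0 (-a 0) with hg
  have hg' : g ∘ ⇑ρ' = Function.update (sortVec a) 0 (-a 0) := by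
    funext s
    simp only [Function.comp_apply]
    by_cases hs0 : s = 0
    · rw [hs0, hρ'0, hg, Function.update_self, Function.update_self]
    · have : ρ' s ≠ 0 := fun h => hs0 (ρ'.injective (h.trans hρ'0.symm))
      rw [hg, Function.update_of_ne this, Function.update_of_ne hs0, hsort, Function.comp_apply]
  have hgmono : Monotone (g ∘ ⇑ρ') := by
    rw [hg']
    intro s s' hss'
    by_cases hs0 : s = 0
    · subst hs0
      rw [Function.update_self]
      by_cases hs'0 : s' = 0
      · subst hs'0; rw [Function.update_self]
      · rw [Function.update_of_ne hs'0]
        have : sortVec a 0 ≤ sortVec a s' := monotone_sortVec a (Fin.zero_le _)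
        linarith
    · have hs'0 : s' ≠ 0 := fun h => hs0 (le_antisymm (h ▸ hss') (Fin.zero_le _))
      rw [Function.update_of_ne hs0, Function.update_of_ne hs'0]
      exact monotone_sortVec a hss'
  rw [← comp_eq_sortVec_of_monotone hgmono, hg']

/-! ### The orbit representative `Φ_{D_n}` and the composite canonical map -/

/-- **`Φ_{D_n}(x)`**: "`Φ_{D_n}(x)` arises from `|x|↑` (`= sort |x|`) by multiplying the first component by
`−1` in case `x` has an odd number of negative components" — written with the sign of `∏ x_i` (for a
vector with a zero coordinate the first component of `sort |x|` is `0` and the sign change is void, so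
the two readings agree, `dnRep_eq_of_odd` / `dnRep_eq_of_even`). [cite: KaibelPashkovich2011, §4.1.4 (arXiv p. 11)] -/
def dnRep (x : Fin (m + 1) → ℝ) : Fin (m + 1) → ℝ :=
  if 0 ≤ ∏ i, x i then sortVec (absVec x)
  else Function.update (sortVec (absVec x)) 0 (-(sortVec (absVec x) 0))

/-- **`τ* ∘ ⋯ ∘ τ* ∘ η* ∘ ⋯ ∘ η*(w) = Φ_{D_n}(w)`**, part one: sorting the output of the `η*`-chain gives
`Φ_{D_n}(w)`. [cite: KaibelPashkovich2011, Prop. 7, proof (arXiv p. 11)] -/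
theorem sortVec_canonSeq_paritySeq (w : Fin (m + 1) → ℝ) :
    sortVec (canonSeq (paritySeq m) w) = dnRep w := by
  obtain ⟨π, h1, h0, hmin, hprod⟩ := eta_spec m w
  set e := canonSeq (paritySeq m) w with he
  set a : Fin (m + 1) → ℝ := absVec w ∘ ⇑π with ha
  have ha' : ∀ i, a i = |w (π i)| := fun i => rfl
  have hamin : ∀ i, a 0 ≤ a i := fun i => by rw [ha', ha']; exact hmin i
  have ha0 : 0 ≤ a 0 := abs_nonneg _
  have hsorta : sortVec a = sortVec (absVec w) := sortVec_comp_perm _ _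
  by_cases hsign : 0 ≤ e 0
  · -- `e = |w| ∘ π ≥ 0`, product `≥ 0`
    have he' : e = a := by
      funext i
      by_cases hi : i = 0
      · rw [hi, ha', ← h0, abs_of_nonneg hsign]
      · rw [h1 i hi, ha']
    have hpos : 0 ≤ ∏ i, w i := by
      rw [← hprod, he']
      exact Finset.prod_nonneg fun i _ => by rw [ha']; exact abs_nonneg _
    rw [dnRep, if_pos hpos, he', hsorta]
  · -- `e 0 = −a 0 < 0`, all other entries `= a i ≥ a 0 > 0`, product `< 0`
    push Not at hsign
    have he0 : e 0 = -a 0 := by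
      rw [ha', ← h0, ← neg_neg (e 0), abs_neg, abs_of_nonneg (by linarith)]
      -- `|−e 0| = −e 0` since `e 0 < 0`
    have he' : e = Function.update a 0 (-a 0) := by
      funext i
      by_cases hi : i = 0
      · rw [hi, Function.update_self, he0]
      · rw [Function.update_of_ne hi, h1 i hi, ha']
    have ha0pos : 0 < a 0 := by
      rcases ha0.eq_or_lt with h | h
      · exfalso; rw [he0, ← h] at hsign; simp at hsign
      · exact h
    have hneg : ¬ 0 ≤ ∏ i, w i := by
      rw [← hprod, he', Fin.prod_univ_succ, Function.update_self]
      have hrest : 0 < ∏ i : Fin m, Function.update a 0 (-a 0) i.succ := by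
        refine Finset.prod_pos fun i _ => ?_
        rw [Function.update_of_ne (Fin.succ_ne_zero i)]
        exact lt_of_lt_of_le ha0pos (hamin _)
      push Not
      exact mul_neg_of_neg_of_pos (by linarith) hrest
    obtain ⟨hfirst, hupd⟩ := sortVec_update_neg_min hamin ha0
    rw [dnRep, if_neg hneg, he', hupd, hsorta, ← hsorta, hfirst]

/-- **`Φ_{D_n}` is an orbit invariant**: `Φ(γ.ε.v) = Φ(v)` for a coordinate permutation `γ` and an EVEN
sign change `ε` (`|w| ` is a permutation of `|v|`, and the product is unchanged).
[cite: KaibelPashkovich2011, Prop. 7, proof (arXiv p. 11: "`= Φ_{D_n}(w) = Φ_{D_n}(v)`")] -/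
theorem dnRep_flipSigns_comp_perm (σ : Equiv.Perm (Fin (m + 1))) {S : Finset (Fin (m + 1))}
    (hS : Even S.card) (v : Fin (m + 1) → ℝ) : dnRep (flipSigns S v ∘ ⇑σ) = dnRep v := by
  have habs : sortVec (absVec (flipSigns S v ∘ ⇑σ)) = sortVec (absVec v) := by
    rw [absVec_comp_perm, sortVec_comp_perm, absVec_flipSigns]
  have hprod : ∏ i, (flipSigns S v ∘ ⇑σ) i = ∏ i, v i := by
    rw [show (fun i => (flipSigns S v ∘ ⇑σ) i) = fun i => flipSigns S v (σ i) from rfl,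
      Equiv.prod_comp σ (flipSigns S v)]
    simp only [flipSigns]
    rw [Finset.prod_mul_distrib, Finset.prod_ite_mem, Finset.univ_inter, Finset.prod_const,
      hS.neg_one_pow, one_mul]
  rw [dnRep, dnRep, habs, hprod]

/-! ### Proposition 7 and Theorem 6 -/

/-- **KP11 Proposition 7** (general polytope): for a sorting network, the sequence
`(T_{k_1,ℓ_1}, …, T_{k_r,ℓ_r}, E_{1,2}, …, E_{n−1,n})` maps `P = conv V` onto `Π_{D_n}(P)` provided
`Φ_{D_n}(v) ∈ P` for every `v ∈ V`. [cite: KaibelPashkovich2011, Prop. 7 (arXiv p. 11)] -/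
theorem KaibelPashkovich2011_prop7 {N : ComparatorNetwork (m + 1)} (hN : N.IsSorting)
    {P V : Set (Fin (m + 1) → ℝ)} (hPV : P = convexHull ℝ V) (hΦ : ∀ v ∈ V, dnRep v ∈ P) :
    seqImage (transSeq N ++ paritySeq m) P = dnHull P := by
  apply KaibelPashkovich2011_thm1 (W := dnOrbit V)
  · rw [hPV, dnHull_convexHull]
  · rw [hPV]; exact convex_convexHull ℝ V
  · exact subset_dnHull P
  · intro h hh
    rcases List.mem_append.1 hh with hh | hh
    · obtain ⟨c, -, hne, rfl⟩ := mem_transSeq hh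
      exact transVec_ne_zero hne
    · exact (paritySeq_spec m h hh).1
  · intro h hh x hx
    rcases List.mem_append.1 hh with hh | hh
    · obtain ⟨c, -, hne, rfl⟩ := mem_transSeq hh
      dsimp only
      rw [reflectAt_transVec hne]
      exact comp_swap_mem_dnHull _ _ hx
    · exact (paritySeq_isDnGenerator m h hh).mem_dnHull hx
  · intro w hw
    obtain ⟨⟨⟨σ, S⟩, hS⟩, ⟨v, hv, rfl⟩⟩ := Set.mem_iUnion.1 hw
    dsimp only
    rw [canonSeq_append, hN.canonSeq_transSeq, sortVec_canonSeq_paritySeq,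
      dnRep_flipSigns_comp_perm σ hS v]
    exact hΦ v hv

/-- **KP11 Theorem 6** (explicit network of `r'` comparators): under the hypotheses of Proposition 7,
an EF of `P` with `r` inequalities gives one of `Π_{D_n}(P)` with `r + 2r' + 4(n − 1)` inequalities
(`n = m + 1`). [cite: KaibelPashkovich2011, Thm. 6 (arXiv p. 11)] -/
theorem KaibelPashkovich2011_thm6 {N : ComparatorNetwork (m + 1)} (hN : N.IsSorting)
    {P V : Set (Fin (m + 1) → ℝ)} (hPV : P = convexHull ℝ V) (hΦ : ∀ v ∈ V, dnRep v ∈ P) {r : ℕ}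
    (h : HasEFOfSize P r) : HasEFOfSize (dnHull P) (r + 2 * N.length + 4 * m) := by
  have h' := h.seqImage (transSeq N ++ paritySeq m)
  rw [KaibelPashkovich2011_prop7 hN hPV hΦ, List.length_append, length_paritySeq] at h'
  have := length_transSeq_le N
  exact h'.of_le (by omega)

/-- **KP11 Theorem 6, unconditionally `r + O(n log² n)`**: with Batcher's network,
`xc(Π_{D_n}(P)) ≤ r + n(⌈log₂ n⌉² + 4) + 4(n − 1)` (printed: `f' + O(n log n)` via AKS).
[cite: KaibelPashkovich2011, Thm. 6 (arXiv p. 11)] -/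
theorem KaibelPashkovich2011_thm6_nlogsq {P V : Set (Fin (m + 1) → ℝ)} (hPV : P = convexHull ℝ V)
    (hΦ : ∀ v ∈ V, dnRep v ∈ P) {r : ℕ} (h : HasEFOfSize P r) :
    HasEFOfSize (dnHull P)
      (r + (m + 1) * (Nat.clog 2 (m + 1) * Nat.clog 2 (m + 1) + 4) + 4 * m) := by
  obtain ⟨T, hT, hlen⟩ := (ComparatorNetwork.isSorting_oeSort (Nat.clog 2 (m + 1))).restrict
    (Nat.le_pow_clog one_lt_two (m + 1))
  refine (KaibelPashkovich2011_thm6 hT hPV hΦ h).of_le ?_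
  have h1 := ComparatorNetwork.length_oeSort (Nat.clog 2 (m + 1))
  have h2 := ComparatorNetwork.two_pow_clog_le (show 1 ≤ m + 1 by omega)
  have h3 : (Nat.clog 2 (m + 1) * Nat.clog 2 (m + 1) + 4) * 2 ^ Nat.clog 2 (m + 1) ≤
      2 * ((m + 1) * (Nat.clog 2 (m + 1) * Nat.clog 2 (m + 1) + 4)) :=
    calc (Nat.clog 2 (m + 1) * Nat.clog 2 (m + 1) + 4) * 2 ^ Nat.clog 2 (m + 1)
        ≤ (Nat.clog 2 (m + 1) * Nat.clog 2 (m + 1) + 4) * (2 * (m + 1)) := Nat.mul_le_mul_left _ h2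
      _ = 2 * ((m + 1) * (Nat.clog 2 (m + 1) * Nat.clog 2 (m + 1) + 4)) := by ring
  omega


/-! ### `Φ_{D_n}` as printed: the parity of the number of negative components -/

/-- `Φ_{D_n}` verbatim: negate the first component of `sort |x|` iff `x` has an odd number of negative
components. [cite: KaibelPashkovich2011, §4.1.4 (arXiv p. 11)] -/
def dnRepPrinted (x : Fin (m + 1) → ℝ) : Fin (m + 1) → ℝ :=
  if Even (univ.filter fun i => x i < 0).card then sortVec (absVec x)
  else Function.update (sortVec (absVec x)) 0 (-(sortVec (absVec x) 0))

/-- The first entry of `sort(a)` is a lower bound of all entries. [cite: KaibelPashkovich2011, §4.1.2 (arXiv p. 10)] -/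
theorem sortVec_zero_le (a : Fin (m + 1) → ℝ) (i : Fin (m + 1)) : sortVec a 0 ≤ a i := by
  have h := monotone_sortVec a (Fin.zero_le ((Tuple.sort a).symm i))
  rw [sortVec, Function.comp_apply, Function.comp_apply, Equiv.apply_symm_apply] at h
  exact h

/-- For `x` without zero components, `∏ x_i ≥ 0` iff the number of negative components is even.
[cite: KaibelPashkovich2011, §4.1.4 (arXiv p. 11)] -/
theorem prod_nonneg_iff_even {x : Fin (m + 1) → ℝ} (hx : ∀ i, x i ≠ 0) :
    0 ≤ ∏ i, x i ↔ Even (univ.filter fun i => x i < 0).card := by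
  have hsplit : ∏ i, x i = (-1) ^ (univ.filter fun i => x i < 0).card * ∏ i, |x i| := by
    have : ∀ i ∈ (univ : Finset (Fin (m + 1))), x i = (if x i < 0 then -1 else 1) * |x i| := by
      intro i _
      split_ifs with h
      · rw [abs_of_neg h]; ring
      · rw [abs_of_nonneg (not_lt.1 h)]; ring
    rw [Finset.prod_congr rfl this, Finset.prod_mul_distrib, Finset.prod_ite, Finset.prod_const_one,
      mul_one, Finset.prod_const]
  have hpos : 0 < ∏ i, |x i| := Finset.prod_pos fun i _ => abs_pos.2 (hx i)
  rw [hsplit]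
  rcases Nat.even_or_odd (univ.filter fun i => x i < 0).card with h | h
  · rw [h.neg_one_pow, one_mul]
    exact ⟨fun _ => h, fun _ => hpos.le⟩
  · rw [h.neg_one_pow]
    constructor
    · intro h'; nlinarith
    · intro h'; exact absurd h' (Nat.not_even_iff_odd.2 h)

/-- The product form `dnRep` agrees with the printed `Φ_{D_n}` (with a zero component both are
`sort |x|`, whose first entry is then `0`). [cite: KaibelPashkovich2011, §4.1.4 (arXiv p. 11)] -/
theorem dnRep_eq_dnRepPrinted (x : Fin (m + 1) → ℝ) : dnRep x = dnRepPrinted x := by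
  by_cases hx : ∀ i, x i ≠ 0
  · rw [dnRep, dnRepPrinted]
    simp only [prod_nonneg_iff_even hx]
  · push Not at hx
    obtain ⟨i, hi⟩ := hx
    have h0 : sortVec (absVec x) 0 = 0 := by
      apply le_antisymm
      · have := sortVec_zero_le (absVec x) i
        rwa [absVec, hi, abs_zero] at this
      · rw [sortVec, Function.comp_apply]
        exact abs_nonneg _
    have hupd : Function.update (sortVec (absVec x)) 0 (-(sortVec (absVec x) 0)) = sortVec (absVec x) := by
      rw [h0, neg_zero, ← h0, Function.update_eq_self]
    rw [dnRep, dnRepPrinted, hupd]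
    simp

end Literature.Combinatorics.Optimization

end
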